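import Summits.Langlands.Langlands.Theses.IrreducibilityBySelfDuality
import Literature.NumberTheory.Automorphic.SelfdualGL3AdjointLiftProofs
import Literature.NumberTheory.Automorphic.ArchParameterUnique

/-!
# Line `petersson-hermitian-parity` — skeleton for crux `RegularAdjointLiftCM` (stmt-Langlands-13617)

Route `route-Langlands-IrreducibilityBySelfDuality` (crux rank 2); crux decl
`Summit.Langlands.Langlands.Theses.IrreducibilityBySelfDuality.RegularAdjointLiftCM`, concluded BY NAME
by `RegularAdjointLiftCM_of` below.  Line card: `Lines/petersson-hermitian-parity.md` (idea, stubs,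
hardest stub, barriers, Disproof used, triage answers).  Planner
`planner-cruxplan-stmt-Langlands-13617-petersson-hermitian--0`, 2026-08-16 (crux-plan, round 1).

## Shape

Five registered stubs `stub_adjointArchIdentity`, `stub_integralPairing`, `stub_hermitianPurity`
(the LEVER of the idea), `stub_centralCharacterArch`, `stub_twistRealisation` — each
`theorem stub_… : <statement> := by sorry` with its statement written out SELF-CONTAINED over
Mathlib + Literature constants (no local `def … : Prop`), so that the registered signature is exactly
what a stub worker re-states in a `Theorems/` file — and the ADMIT-FREE composition
`RegularAdjointLiftCM_of (hTwist : HalfIntegralTwistCM) : RegularAdjointLiftCM`, whose only hypothesis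
is the route's OWN crux `HalfIntegralTwistCM` (item stmt-Langlands-14036, rank 4, a TAGGED route decl:
the CM unit lever, used by name exactly as the route's two-layer plan foresaw; verdict of its standing
disprover: TRUE as typed).

## Logical geography

By the standing disprover's checked anatomy (`Cruxes/RegularAdjointLiftCM/Disproof.lean` §1, §3:
`RegularAdjointLiftCM ↔ (SelfdualGL3AdjointLift → CMStep)` by `Iff.rfl`; the Satake half of `CMStep`
is FREE — `adParams_map_mul`, landed as `Theorems/RegularAdjointLiftCM/Negative/KillCriterion.lean`,
repeated verbatim below) the crux is: over a CM field, Ramakrishnan's descent `(σ₀, ν)` of a regular algebraic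
essentially self-dual cuspidal `π` on `GL₃` admits a REGULAR ALGEBRAIC a.e. Satake twist `σ` of `σ₀`,
and `ν` is algebraic.  The line:

1. `stub_adjointArchIdentity` (ADJ∞; Gelbart–Jacquet Thm 9.3 AT INFINITY + Jacquet–Shalika II Thm 4.4
   with archimedean components, on Harish-Chandra multisets): `HC(σ₀, ι) = {a₁ ι, a₂ ι}`,
   `HC(ν, ι) = {c ι}`, `HC(π, ι) = {a₁ - a₂ + c, c, a₂ - a₁ + c}`.
2. Reading `π.IsRegularAlgebraic` (GLUE, proved here): `c ι ∈ ℤ` and `a₁ ι - a₂ ι ∈ ℤ ∖ {0}`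
   (uniqueness of archimedean parameters, `hasArchParameter_unique`, PROVED in the tree); hence `ν` is
   regular algebraic (its infinity type `(c ι, c ῑ)` is written down — no stub).
3. `stub_integralPairing` (archimedean local Langlands for `GL₂`, the tree's named fact
   `exists_hasInfinityType` in labelled form): relabel `HC(σ₀, ι) = {s₁ ι, s₂ ι}` with
   `s_j ι - s_j ῑ ∈ ℤ`.
4. `stub_hermitianPurity` (THE LEVER — Petersson skew-adjointness of `𝔤` on cusp forms +
   `HasArchParameter.map_neg_conj_of_skewHermitian`, both PROVED in the tree, joined for the first
   time): `HC(σ₀, ῑ) = {-s̄ + c₀ : s ∈ HC(σ₀, ι)}`.  GLUE: with `s₁ ι - s₂ ι = a ∈ ℤ` this forces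
   `(s₁ - s₂)(ι) + (s₁ - s₂)(ῑ) ∈ {0, 2a}` — EVEN: hypothesis (iii) of `HalfIntegralTwistCM`, with no
   appeal to the unproved `Clozel1990_regularAlgebraic.purity` and no classification of the unitary
   dual of `GL₂(ℂ)` (exactly the input the sibling disprover isolated: `cmParity_obstructed` /
   `cmParity_sufficient` of `Theorems/RegularTwistCM/Negative/ArchShadowParity.lean`).
5. `stub_centralCharacterArch` (CC∞; the centre theorem, PROVED in the tree, + the GL(1) dictionary):
   the central character of `σ₀` is a GL(1) datum `ω` with `HC(ω, ι) = {s₁ ι + s₂ ι}` — hypothesis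
   (iv) of `HalfIntegralTwistCM`.
6. `hTwist : HalfIntegralTwistCM` (route item, by name): a GL(1) datum `χ` with `HC(χ, ι) = {p ι}`,
   `p ι + s₁ ι ∈ ½ + ℤ`.
7. `stub_twistRealisation` (the a.e. Satake twist `σ = σ₀ ⊗ χ` with its archimedean shift by a GENERAL
   — non-algebraic, non-unitary — GL(1) datum, and the regular-algebraic certificate): `σ` regular
   algebraic with `t_σ = c_v t_{σ₀}` a.e.
8. GLUE (Satake algebra, after Disproof §3): non-dihedrality and `t_π = d · Ad(t_σ)` transport along the
   twist (`Ad` is blind to twists).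
-/

set_option linter.dupNamespace false

noncomputable section

open scoped BigOperators Classical ComplexConjugate

namespace Summit.Langlands.Langlands.Cruxes.RegularAdjointLiftCM.PeterssonHermitianParity

/-! ## The five registered stubs (self-contained statements; the only `sorry`s of the line) -/

/-- **Stub 1 — ADJ∞, the archimedean adjoint identity on Harish-Chandra multisets** (verbatim the
shared typed input `AdjointArchIdentity` of `Cruxes/RegularAdjointLiftCM/SketchIdeator3.lean`; any
number field).  If `π` is cuspidal on `GL₃(𝔸_K)`, `σ₀` cuspidal NON-DIHEDRAL on `GL₂(𝔸_K)`, `ν` a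
GL(1) datum and `t_{π,v} = d_v · Ad(t_{σ₀,v})` for almost all `v`, then for Harish-Chandra parameters
`{a₁ ι, a₂ ι}` of `σ₀` and `{c ι}` of `ν` the parameter of `π` at `ι` is
`{a₁ ι - a₂ ι + c ι, c ι, a₂ ι - a₁ ι + c ι}`.  Paper: `Ad(σ₀)` is cuspidal (Gelbart–Jacquet Thm 9.3,
`σ₀` non-dihedral), `π` and `Ad(σ₀) ⊗ ν` are cuspidal and nearly equivalent, hence have the same
archimedean components (Jacquet–Shalika 1981 II, Thm 4.4 — in the tree as
`hasArchParameter_eq_of_isNearlyEquivalent` modulo its `L²` leaves), and the archimedean adjoint lift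
has the adjoint infinitesimal character (GJ Thm 9.3 local–global compatibility at `w ∣ ∞`).  Why it
might fail AS TYPED: the `(ι, ῑ) ↔ (z, z̄)` bookkeeping of `HasArchParameter` at complex places and the
existence of SOME parameter for `σ₀`, `ν` (infinitesimal characters of irreducible admissible
Borel–Jacquet data: `exists_hasArchParameter_of_hasInfinitesimalCharacter`).  HARDEST stub (no tree
shadow of GJ at infinity).  Size XL in Lean, known on paper.
[cite: GelbartJacquet1978, Thm 9.3] [cite: JacquetShalikaAJM1981II, Thm 4.4] -/
theorem stub_adjointArchIdentity :
    ∀ (K : Type) [Field K] [NumberField K]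
      (h1 : Literature.NumberTheory.Automorphic.isCompact_glFiniteIntegralLevel 1 K)
      (h2 : Literature.NumberTheory.Automorphic.isCompact_glFiniteIntegralLevel 2 K)
      (h3 : Literature.NumberTheory.Automorphic.isCompact_glFiniteIntegralLevel 3 K)
      (π : Literature.NumberTheory.Automorphic.CuspidalAutomorphicRepData 3 K h3)
      (σ₀ : Literature.NumberTheory.Automorphic.CuspidalAutomorphicRepData 2 K h2)
      (ν : Literature.NumberTheory.Automorphic.CuspidalAutomorphicRepData 1 K h1),
      (∀ (L : Type) [Field L] [NumberField L] [Algebra K L], Module.finrank K L = 2 →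
        ¬ (∀ᶠ v in Filter.cofinite, ∀ β : Multiset ℂ, σ₀.1.HasSatakeParamAt v β →
          β.map (fun b => (if ∃ w : IsDedekindDomain.HeightOneSpectrum (NumberField.RingOfIntegers L),
              w.asIdeal.under (NumberField.RingOfIntegers K) = v.asIdeal ∧
                w.asIdeal.inertiaDeg (NumberField.RingOfIntegers K) = 1 then (1 : ℂ) else -1) * b) = β)) →
      (∀ᶠ v in Filter.cofinite, ∀ α β : Multiset ℂ, π.1.HasSatakeParamAt v α →
        σ₀.1.HasSatakeParamAt v β →
          ∃ d : ℂ, ν.1.HasSatakeParamAt v {d} ∧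
            α = (((β ×ˢ β).map (fun p : ℂ × ℂ => p.1 * p.2⁻¹)).erase 1).map (fun c => d * c)) →
      ∃ (a₁ a₂ c : (K →+* ℂ) → ℂ),
        σ₀.1.HasArchParameter (fun ι => {a₁ ι, a₂ ι}) ∧ ν.1.HasArchParameter (fun ι => {c ι}) ∧
        π.1.HasArchParameter (fun ι => {a₁ ι - a₂ ι + c ι, c ι, a₂ ι - a₁ ι + c ι}) := by
  sorry

/-- **Stub 2 — integral pairing of the descent's parameter (archimedean local Langlands for `GL₂`,
labelled form).**  Any archimedean parameter `χ₀` of a cuspidal `GL₂` datum `σ₀` over any number field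
admits a labelling `χ₀ ι = {s₁ ι, s₂ ι}` with `s_j ι - s_j ῑ ∈ ℤ` for `j = 1, 2` at every embedding
`ι` (at a real place `ῑ = ι` and the condition is empty; at a complex place `w` the Langlands parameter
of `σ₀,w` restricted to `ℂˣ` is `z^{s₁} z̄^{t₁} ⊕ z^{s₂} z̄^{t₂}` with `s_j - t_j ∈ ℤ`, and
`χ₀ σ_w = {s₁, s₂}`, `χ₀ σ̄_w = {t₁, t₂}`).  In the tree: the named fact
`AutomorphicRepData.exists_hasInfinityType` (a WELL-FORMED infinity type: `T ῑ = (T ι).map swap`,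
`ArchWeight.exists_int_sub`) + uniqueness `hasArchParameter_unique` (proved) + a choice of one
embedding per complex place.  This is the input triage isolated for every line ("integral pairing",
TRIAGE-r1-1 shared finding, r1-3 header).  Why it might fail AS TYPED: only through the named fact
(Harish-Chandra / Langlands classification for `GL₂(ℝ)`, `GL₂(ℂ)`); convention-robust (any pairing of
the two multisets serves).  Size M given the fact; L with it.
[cite: Clozel1990, §3.3] [cite: Knapp2002, Thm. 5.44] -/
theorem stub_integralPairing :
    ∀ (K : Type) [Field K] [NumberField K]
      (h2 : Literature.NumberTheory.Automorphic.isCompact_glFiniteIntegralLevel 2 K)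
      (σ₀ : Literature.NumberTheory.Automorphic.CuspidalAutomorphicRepData 2 K h2)
      (χ₀ : (K →+* ℂ) → Multiset ℂ), σ₀.1.HasArchParameter χ₀ →
      ∃ s₁ s₂ : (K →+* ℂ) → ℂ, (∀ ι, χ₀ ι = {s₁ ι, s₂ ι}) ∧
        ∀ ι, (∃ m : ℤ, s₁ ι - s₁ (NumberField.ComplexEmbedding.conjugate ι) = m) ∧
          (∃ m : ℤ, s₂ ι - s₂ (NumberField.ComplexEmbedding.conjugate ι) = m) := by
  sorry

/-- **Stub 3 — THE LEVER: Petersson–Hermitian symmetry of the archimedean parameter of EVERY cuspidal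
datum** (same statement as the sibling crux's `HermitianArchSymmetryCuspidal`,
`Cruxes/RegularTwistCM/SketchIdeator1.lean`, so one proof serves both cruxes).  For `π` cuspidal on
`GL_n(𝔸_K)` (`n ≥ 1`, any number field) with archimedean parameter `χ` there is a REAL `c` with
`χ(ῑ) = {-ā + c : a ∈ χ(ι)}` at every embedding — Clozel's purity lemma ON MULTISETS for all cuspidal
data (weight `c`), not only regular algebraic ones.  Proof plan, all pieces PROVED in the tree:
(1) clean model `π₀ = C/⊥ ≅ W/W'` with the same parameters, `A_G` acting by `a^{μ}`
(`exists_isShiftRealisation_of_sSup_irreducible` + `stable_cuspidal_eq_sSup_irreducible_holds`,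
`IsShiftRealisation.hasArchParameter(_of_clean)`); (2) real twist `π₁ = π₀ ⊗ |det|^{s}`,
`s = -Re μ / n[K:ℚ]`, parameter `χ + s` (`HasArchParameter.of_map_mulChar_detTwist`), `A_G` now acting
by the UNITARY character `a^{i Im μ}` (template: `ArthurClozel1989_strongLifting_archimedean_of_clean_unitaryCentral`);
(3) the NEW piece (M): a `𝔤`-skew-Hermitian sesquilinear form with `B(v,v) ≠ 0` on `π₁.Quot` for the
Lie action — the Petersson form `B(φ, ψ) = ⟪ψ, φ⟫` (`PeterssonSpace`, `inner_uAct`,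
`IsLieStableSmooth.l2Pairing_envelopingAction`, `l2Pairing_lieDeriv_add_eq_zero`, positivity
`l2Pairing_self` / `eq_zero_of_l2Pairing_self_eq_zero`, boundedness `cuspidal_bounded_holds`), after
making `A_G` act TRIVIALLY by the unitary twist `|det|^{-i Im μ / n[K:ℚ]}` (needs the purely-imaginary
case of `of_map_mulChar_detTwist`, i.e. `HasHCParameter.of_add_smul_one` for complex `δ` — shared with
Stub 5) or by descending `φ ψ̄` (which IS `A_G`-invariant) to the quotient; (4)
`HasArchParameter.map_neg_conj_of_skewHermitian` gives `(χ + s)(ῑ) = {-conj(a + s)}`, i.e. the claim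
with `c = -2s`; (5) untwist and transfer back.  Why it might fail: it should not (Knapp–Vogan IX §1);
the decisive convention check is the sign `ρ` vs `-ρᵀ` between `uAct` and `HasLieAction` (cheapest
falsifier of the card: instantiate on `|det|^{1/2}`-type GL(1) data).  `n = 0` excluded by `NeZero`.
Size M–L in Lean.
[cite: KnappVogan1995, Ch. IX §1 (p. 597)] [cite: Clozel1990, Lemme 4.9] -/
theorem stub_hermitianPurity :
    ∀ (n : ℕ) [NeZero n] (K : Type) [Field K] [NumberField K]
      (hcpt : Literature.NumberTheory.Automorphic.isCompact_glFiniteIntegralLevel n K)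
      (π : Literature.NumberTheory.Automorphic.CuspidalAutomorphicRepData n K hcpt)
      (χ : (K →+* ℂ) → Multiset ℂ), π.1.HasArchParameter χ →
      ∃ c : ℝ, ∀ ι : K →+* ℂ,
        χ (NumberField.ComplexEmbedding.conjugate ι) = (χ ι).map (fun a => -(starRingEnd ℂ a) + (c : ℂ)) := by
  sorry

/-- **Stub 4 — CC∞, the central character as a GL(1) datum with the SUM parameter** (verbatim the
shared typed input `CentralCharacterArch` of `Cruxes/RegularAdjointLiftCM/SketchIdeator3.lean`).  For
`π` cuspidal on `GL_n(𝔸_K)`, `n ≥ 1`, with archimedean parameter `A` there is a cuspidal GL(1) datum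
`ω` (its central character) with parameter `ι ↦ {Σ A ι}` and Satake parameter `{∏ α}` wherever `π` has
Satake parameter `α`.  In the tree: the centre theorem `centralCharacter_det_ofInfinite_expGL` /
`HasArchParameter.lieDeriv_scalar_sub_smul_mem` (the central `x · 1ₙ` acts by `Σ_w (x_w Σ A_w + x̄_w Σ A'_w)`,
PROVED), `AutomorphicRepData.exists_centralCharacter` (with the Satake shadow `ω(ϖ_v) = ∏ α`, PROVED),
the GL(1) dictionary `exists_cuspidal_glOne_hasSatakeParamAt_valueAtUniformizer` and
`hasArchParameter_glOne_of_eq_smul_one` (non-algebraic GL(1) parameters, PROVED).  Why it might fail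
AS TYPED: a `ρ`/normalisation constant in "HC sum = differential of `ω`" (triage r1-1's one flagged
misstatement risk) — checkable on `|det|^{1/2} ⊗ 𝟙`; the Satake clause at EVERY unramified `v` of `π`
needs `ω` unramified there (level prime to `v` ⇒ `𝒪_vˣ` acts trivially).  Size M.
[cite: BorelJacquetCorvallis1979, §4.6 and 5.7] [cite: Clozel1990, §3.3] -/
theorem stub_centralCharacterArch :
    ∀ (n : ℕ) (K : Type) [Field K] [NumberField K]
      (hcpt : Literature.NumberTheory.Automorphic.isCompact_glFiniteIntegralLevel n K)
      (h1 : Literature.NumberTheory.Automorphic.isCompact_glFiniteIntegralLevel 1 K)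
      (π : Literature.NumberTheory.Automorphic.CuspidalAutomorphicRepData n K hcpt)
      (A : (K →+* ℂ) → Multiset ℂ), 0 < n → π.1.HasArchParameter A →
      ∃ ω : Literature.NumberTheory.Automorphic.CuspidalAutomorphicRepData 1 K h1,
        ω.1.HasArchParameter (fun ι => {(A ι).sum}) ∧
        ∀ (v : IsDedekindDomain.HeightOneSpectrum (NumberField.RingOfIntegers K)) (α : Multiset ℂ),
          π.1.HasSatakeParamAt v α → ω.1.HasSatakeParamAt v {α.prod} := by
  sorry

/-- **Stub 5 — the regular algebraic re-twist, realised** (the route's foreseen child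
`RegularTwistRealisation`, any number field).  Given the cuspidal `GL₂` datum `σ₀` with parameter
`{s₁ ι, s₂ ι}` (integral non-zero gap, `s₁` integrally paired with its conjugate) and a GL(1) datum `χ`
with parameter `{p ι}` such that `p ι + s₁ ι ∈ ½ + ℤ` everywhere, there is a cuspidal `GL₂` datum `σ`
— the twist `σ₀ ⊗ (θ_χ ∘ det)` — which is an a.e. Satake twist of `σ₀` by `χ` and is REGULAR
ALGEBRAIC.  Three pieces: (i) the a.e. Satake twist by the Hecke character `θ_χ` of `χ`
(`CuspidalAutomorphicRepData.exists_twist_hecke_hasSatakeParamAt`, PROVED for every Hecke character;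
GL(1) dictionary `exists_heckeCharacter_satake_eq` of the landed Negative module `KillCriterion`); (ii) the
archimedean parameter of the twist is `{s_j ι + p ι}` — the shift of the Lie action by the differential
of `θ_χ ∘ det`, the generalisation of `HasArchParameter.of_map_mulChar_detTwist` (real `|det|^s` only
in the tree) to an arbitrary, non-unitary, infinite-order Hecke character ("T-complex", flagged by every
triager; `p ι` IS that differential by `hasArchParameter_glOne_of_eq_smul_one` + `hasArchParameter_unique`);
(iii) the RA certificate (bookkeeping, as ideator 1's `isRegularAlgebraic_of_hasArchParameter_halfInt`):
`T ι = {(s₁ ι + p ι, s₁ ῑ + p ῑ), (s₂ ι + p ι, s₂ ῑ + p ῑ)}` is well formed (`p ι - p ῑ ∈ ℤ` follows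
from the hypotheses), C-algebraic (`½ + ℤ`), regular (`a ≠ 0`).  Why it might fail: the strengthenings
"`χ` algebraic / unitary / one global `|·|^s`" are FALSE (sibling Negative lemmas
`imaginaryTwist_notAlgebraic`, `noGlobalExponent_of_maassType`) — none is asked here; the real risk is
formalisation depth of (ii).  Size L.
[cite: BorelJacquetCorvallis1979, §4.6] [cite: Clozel1990, Déf. 1.8 and 3.12] -/
theorem stub_twistRealisation :
    ∀ (K : Type) [Field K] [NumberField K]
      (h1 : Literature.NumberTheory.Automorphic.isCompact_glFiniteIntegralLevel 1 K)
      (h2 : Literature.NumberTheory.Automorphic.isCompact_glFiniteIntegralLevel 2 K)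
      (σ₀ : Literature.NumberTheory.Automorphic.CuspidalAutomorphicRepData 2 K h2)
      (χ : Literature.NumberTheory.Automorphic.CuspidalAutomorphicRepData 1 K h1)
      (s₁ s₂ p : (K →+* ℂ) → ℂ),
      σ₀.1.HasArchParameter (fun ι => {s₁ ι, s₂ ι}) →
      χ.1.HasArchParameter (fun ι => {p ι}) →
      (∀ ι, ∃ a : ℤ, a ≠ 0 ∧ s₁ ι - s₂ ι = a) →
      (∀ ι, ∃ m : ℤ, s₁ ι - s₁ (NumberField.ComplexEmbedding.conjugate ι) = m) →
      (∀ ι, ∃ m : ℤ, p ι + s₁ ι - 1 / 2 = m) →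
      ∃ σ : Literature.NumberTheory.Automorphic.CuspidalAutomorphicRepData 2 K h2,
        σ.1.IsRegularAlgebraic ∧
        ∀ᶠ v in Filter.cofinite, ∀ β : Multiset ℂ, σ₀.1.HasSatakeParamAt v β →
          ∃ c : ℂ, χ.1.HasSatakeParamAt v {c} ∧ σ.1.HasSatakeParamAt v (β.map (fun b => c * b)) := by
  sorry

/-! ## Glue (fully proved: no `sorry` below this line) -/

section Glue

open Filter NumberField IsDedekindDomain
open scoped NumberField
open Literature.NumberTheory.Automorphic
open Summit.Langlands.Langlands.Theses.IrreducibilityBySelfDuality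

variable {K : Type} [Field K] [NumberField K]

/-! ### Satake algebra (after Disproof §3 / the landed Negative module `KillCriterion`) -/

/-- Rankin–Selberg data are blind to a common twist: `{(ca)(cb)⁻¹} = {ab⁻¹}` (`c ≠ 0`)
(verbatim `Theorems/RegularAdjointLiftCM/Negative/KillCriterion.lean`, repeated here only because that
landed module is not yet in the farm snapshot this skeleton is checked against). -/
theorem rsData_map_mul (s t : Multiset ℂ) {c : ℂ} (hc : c ≠ 0) :
    rsData (s.map (c * ·)) (t.map (c * ·)) = rsData s t := by
  induction s using Multiset.induction_on with
  | empty => simp [rsData_zero]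
  | cons a s ih =>
      rw [Multiset.map_cons, rsData_cons, rsData_cons, ih, Multiset.map_map]
      congr 1
      refine Multiset.map_congr rfl fun y _ => ?_
      simp only [Function.comp_apply]
      rw [mul_inv, mul_mul_mul_comm, mul_inv_cancel₀ hc, one_mul]

/-- **`Ad` is twist-invariant**: `Ad(c · β) = Ad(β)` for `c ≠ 0` (verbatim the landed Negative lemma
`Summit.Langlands.Langlands.Theorems.RegularAdjointLiftCM.Negative.adParams_map_mul`). -/
theorem adParams_map_mul (β : Multiset ℂ) {c : ℂ} (hc : c ≠ 0) :
    adParams (β.map (c * ·)) = adParams β := by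
  change (rsData _ _).erase 1 = (rsData _ _).erase 1
  rw [rsData_map_mul β β hc]

/-- A GL(1) Satake value is non-zero. -/
theorem ne_zero_of_hasSatakeParamAt_singleton {h1 : isCompact_glFiniteIntegralLevel 1 K}
    {χ : CuspidalAutomorphicRepData 1 K h1} {v : HeightOneSpectrum (𝓞 K)} {c : ℂ}
    (h : χ.1.HasSatakeParamAt v {c}) : c ≠ 0 :=
  fun h0 => h.zero_not_mem (by simp [h0])

/-- The adjoint relation `t_π = d · Ad(t_σ)` a.e. transports along an a.e. Satake twist `σ₀ ↦ σ`
(`Ad` is blind to twists; Satake uniqueness and a.e. unramifiedness, Flath — all proved). -/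
theorem adRel_transport {h1 : isCompact_glFiniteIntegralLevel 1 K} {h2 : isCompact_glFiniteIntegralLevel 2 K}
    {h3 : isCompact_glFiniteIntegralLevel 3 K} {π : CuspidalAutomorphicRepData 3 K h3}
    {σ σ₀ : CuspidalAutomorphicRepData 2 K h2} {ν χ : CuspidalAutomorphicRepData 1 K h1}
    (h : ∀ᶠ v in cofinite, ∀ α β : Multiset ℂ, π.1.HasSatakeParamAt v α → σ₀.1.HasSatakeParamAt v β →
      ∃ d : ℂ, ν.1.HasSatakeParamAt v {d} ∧ α = (adParams β).map (fun c => d * c))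
    (htw : ∀ᶠ v in cofinite, ∀ β : Multiset ℂ, σ₀.1.HasSatakeParamAt v β →
      ∃ c : ℂ, χ.1.HasSatakeParamAt v {c} ∧ σ.1.HasSatakeParamAt v (β.map (fun b => c * b))) :
    ∀ᶠ v in cofinite, ∀ α β : Multiset ℂ, π.1.HasSatakeParamAt v α → σ.1.HasSatakeParamAt v β →
      ∃ d : ℂ, ν.1.HasSatakeParamAt v {d} ∧ α = (adParams β).map (fun c => d * c) := by
  have hcof : ∀ᶠ v in cofinite, σ₀.1.IsUnramifiedAt v := σ₀.1.hasSatakeParamAt_cofinite_holds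
  filter_upwards [h, htw, hcof] with v hv htv hur α β hα hβ
  obtain ⟨β₀, hβ₀⟩ := hur
  obtain ⟨c, hc, hσ⟩ := htv β₀ hβ₀
  have hββ : β = β₀.map (fun b => c * b) := σ.1.hasSatakeParamAt_unique_holds hβ hσ
  obtain ⟨d, hd, hαd⟩ := hv α β₀ hα hβ₀
  exact ⟨d, hd, by rw [hαd, hββ, adParams_map_mul β₀ (ne_zero_of_hasSatakeParamAt_singleton hc)]⟩

/-- An a.e. self-twist relation `t_σ = ε_v t_σ` transports BACK along an a.e. Satake twist `σ₀ ↦ σ`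
(so non-dihedrality of `σ₀` gives non-dihedrality of `σ`). -/
theorem selfTwist_transport {h1 : isCompact_glFiniteIntegralLevel 1 K} {h2 : isCompact_glFiniteIntegralLevel 2 K}
    {σ σ₀ : CuspidalAutomorphicRepData 2 K h2} {χ : CuspidalAutomorphicRepData 1 K h1}
    (ε : HeightOneSpectrum (𝓞 K) → ℂ)
    (htw : ∀ᶠ v in cofinite, ∀ β : Multiset ℂ, σ₀.1.HasSatakeParamAt v β →
      ∃ c : ℂ, χ.1.HasSatakeParamAt v {c} ∧ σ.1.HasSatakeParamAt v (β.map (fun b => c * b)))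
    (hdi : ∀ᶠ v in cofinite, ∀ β : Multiset ℂ, σ.1.HasSatakeParamAt v β →
      β.map (fun b => ε v * b) = β) :
    ∀ᶠ v in cofinite, ∀ β : Multiset ℂ, σ₀.1.HasSatakeParamAt v β → β.map (fun b => ε v * b) = β := by
  filter_upwards [hdi, htw] with v hv htv β₀ hβ₀
  obtain ⟨c, hc, hσ⟩ := htv β₀ hβ₀
  have hc0 : c ≠ 0 := ne_zero_of_hasSatakeParamAt_singleton hc
  have key := hv (β₀.map (fun b => c * b)) hσ
  rw [Multiset.map_map] at key
  have key' : (β₀.map fun b => ε v * b).map (fun b => c * b) = β₀.map (fun b => c * b) := by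
    rw [Multiset.map_map]
    refine Eq.trans (Multiset.map_congr rfl fun b _ => ?_) key
    simp only [Function.comp_apply]
    ring
  exact Multiset.map_injective (mul_right_injective₀ hc0) key'

/-! ### Multiset and integrality bookkeeping -/

/-- `{a, b} = {c, d}` as multisets iff the pairs agree up to order. -/
theorem pair_eq_pair {a b c d : ℂ} (h : ({a, b} : Multiset ℂ) = {c, d}) :
    (a = c ∧ b = d) ∨ (a = d ∧ b = c) := by
  simp only [Multiset.insert_eq_cons] at h
  rcases Multiset.cons_eq_cons.1 h with ⟨hac, hbd⟩ | ⟨-, cs, hbs, hds⟩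
  · exact Or.inl ⟨hac, Multiset.singleton_inj.1 hbd⟩
  · obtain ⟨hbc, hcs⟩ := (Multiset.singleton_eq_cons_iff cs).1 hbs
    subst hcs
    obtain ⟨hda, -⟩ := (Multiset.singleton_eq_cons_iff 0).1 hds
    exact Or.inr ⟨hda.symm, hbc⟩

omit [NumberField K] in
/-- The `a`-exponents of a C-algebraic infinity type on `GL₃` are integers (`(3 - 1)/2 = 1`). -/
theorem int_of_mem_cAlgebraic_three {T : InfinityType K 3} (hT : T.IsCAlgebraic) (ι : K →+* ℂ) {z : ℂ}
    (hz : z ∈ (T ι).map ArchWeight.a) : ∃ k : ℤ, z = k := by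
  obtain ⟨p, hp, rfl⟩ := Multiset.mem_map.1 hz
  obtain ⟨k, l, hk, -⟩ := hT ι p hp
  exact ⟨k + 1, by rw [hk]; push_cast; ring⟩

/-- A GL(1) datum whose archimedean parameter is integral at every embedding is regular algebraic
(its infinity type `ι ↦ {(c ι, c ῑ)}` is written down; `n = 1`: C-algebraic = integral). -/
theorem isRegularAlgebraic_glOne_of_int {h1 : isCompact_glFiniteIntegralLevel 1 K}
    (ν : CuspidalAutomorphicRepData 1 K h1) (c : (K →+* ℂ) → ℂ)
    (hν : ν.1.HasArchParameter fun ι => {c ι}) (hc : ∀ ι, ∃ k : ℤ, c ι = k) :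
    ν.1.IsRegularAlgebraic := by
  choose k hk using hc
  let T : InfinityType K 1 := fun ι =>
    {⟨(k ι : ℂ), (k (ComplexEmbedding.conjugate ι) : ℂ),
      ⟨k ι - k (ComplexEmbedding.conjugate ι), by push_cast; ring⟩⟩}
  have hTa : (fun ι => (T ι).map ArchWeight.a) = fun ι => {c ι} := by
    funext ι
    simp [T, hk ι]
  refine ⟨T, ⟨⟨fun ι => by simp [T], fun ι => ?_⟩, ?_⟩, ?_, ?_⟩
  · simp only [T, Multiset.map_singleton]
    congr 1
    ext
    · rfl
    · simp [ComplexEmbedding.involutive_conjugate K ι]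
  · rw [hTa]
    exact hν
  · intro ι p hp
    simp only [T, Multiset.mem_singleton] at hp
    subst hp
    exact ⟨k ι, k (ComplexEmbedding.conjugate ι), by simp, by simp⟩
  · intro ι
    simp [T]

/-! ### The composition -/

/-- **The crux from the five stubs and the route's own GL(1) lever `HalfIntegralTwistCM` (item
stmt-Langlands-14036, by name).**  See the module docstring for the eight steps. -/
theorem RegularAdjointLiftCM_of (hTwist : HalfIntegralTwistCM) : RegularAdjointLiftCM := by
  intro hA K _ _ hK h1 h2 h3 π hπ hη
  obtain ⟨η, hη⟩ := hη
  -- (0) Ramakrishnan's descent `(σ₀, ν)` from the input item (the antecedent, fed by name)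
  obtain ⟨σ₀, ν, hnd, hrel⟩ := hA K h1 h2 h3 π η hη
  -- (1) Satake: `t_π = d · Ad(t_{σ₀})` a.e. (Satake uniqueness, Flath — proved)
  have had : ∀ᶠ v in cofinite, ∀ α β : Multiset ℂ, π.1.HasSatakeParamAt v α →
      σ₀.1.HasSatakeParamAt v β →
        ∃ d : ℂ, ν.1.HasSatakeParamAt v {d} ∧ α = (adParams β).map (fun c => d * c) := by
    filter_upwards [hrel] with v hv α β hα hβ
    obtain ⟨d, e, hd, -, -, hP⟩ := hv β hβ
    exact ⟨d, hd, π.1.hasSatakeParamAt_unique_holds hα hP⟩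
  -- (2) ADJ∞
  obtain ⟨a₁, a₂, c, hσ₀par, hνpar, hπpar⟩ := stub_adjointArchIdentity K h1 h2 h3 π σ₀ ν hnd had
  -- (3) read `π` regular algebraic: `c ι ∈ ℤ`, `a₁ ι - a₂ ι ∈ ℤ ∖ {0}`
  obtain ⟨T, hT, hTra⟩ := hπ
  have hTa : ∀ ι, (T ι).map ArchWeight.a = {a₁ ι - a₂ ι + c ι, c ι, a₂ ι - a₁ ι + c ι} :=
    fun ι => congr_fun (π.1.hasArchParameter_unique hT.2 hπpar) ι
  have hcInt : ∀ ι, ∃ k : ℤ, c ι = k := fun ι =>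
    int_of_mem_cAlgebraic_three hTra.1 ι (by rw [hTa ι]; simp)
  have hgapInt : ∀ ι, ∃ k : ℤ, k ≠ 0 ∧ a₁ ι - a₂ ι = k := by
    intro ι
    obtain ⟨k₁, hk₁⟩ : ∃ k : ℤ, a₁ ι - a₂ ι + c ι = k :=
      int_of_mem_cAlgebraic_three hTra.1 ι (by rw [hTa ι]; simp)
    obtain ⟨k₀, hk₀⟩ := hcInt ι
    refine ⟨k₁ - k₀, fun h0 => ?_, by push_cast; linear_combination hk₁ - hk₀⟩
    have hreg := hTra.2 ι
    rw [hTa ι, Multiset.insert_eq_cons, Multiset.nodup_cons] at hreg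
    apply hreg.1
    have e : a₁ ι - a₂ ι = 0 := by
      have h0' : (k₁ : ℂ) - (k₀ : ℂ) = 0 := by exact_mod_cast h0
      linear_combination hk₁ - hk₀ + h0'
    have e' : a₁ ι - a₂ ι + c ι = c ι := by rw [e, zero_add]
    rw [e']
    simp
  -- (4) `ν` is regular algebraic
  have hνRA : ν.1.IsRegularAlgebraic := isRegularAlgebraic_glOne_of_int ν c hνpar hcInt
  -- (5) integral pairing: relabel `{a₁, a₂} = {s₁, s₂}` with `s_j ι - s_j ῑ ∈ ℤ`
  obtain ⟨s₁, s₂, hs, hpair⟩ := stub_integralPairing K h2 σ₀ _ hσ₀par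
  have hσ₀par' : σ₀.1.HasArchParameter (fun ι => {s₁ ι, s₂ ι}) := by
    have e : (fun ι => ({a₁ ι, a₂ ι} : Multiset ℂ)) = fun ι => {s₁ ι, s₂ ι} := funext hs
    rw [← e]
    exact hσ₀par
  have hgap : ∀ ι, ∃ a : ℤ, a ≠ 0 ∧ s₁ ι - s₂ ι = a := by
    intro ι
    obtain ⟨k, hk0, hk⟩ := hgapInt ι
    rcases pair_eq_pair (hs ι) with ⟨e₁, e₂⟩ | ⟨e₁, e₂⟩
    · exact ⟨k, hk0, by rw [← e₁, ← e₂, hk]⟩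
    · exact ⟨-k, neg_ne_zero.2 hk0, by rw [← e₁, ← e₂]; push_cast; linear_combination -hk⟩
  -- (6) THE LEVER: Hermitian symmetry ⇒ the total parity `(s₁-s₂)(ι) + (s₁-s₂)(ῑ)` is even
  obtain ⟨c₀, hc₀⟩ := stub_hermitianPurity 2 K h2 σ₀ _ hσ₀par'
  have hiii : ∀ ι, ∃ m : ℤ, (s₁ ι - s₂ ι) +
      (s₁ (ComplexEmbedding.conjugate ι) - s₂ (ComplexEmbedding.conjugate ι)) = 2 * m := by
    intro ι
    obtain ⟨a, -, ha⟩ := hgap ι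
    have hconj : starRingEnd ℂ (s₁ ι) - starRingEnd ℂ (s₂ ι) = (a : ℂ) := by
      rw [← map_sub, ha, map_intCast]
    have key := hc₀ ι
    simp only [Multiset.insert_eq_cons, Multiset.map_cons, Multiset.map_singleton] at key
    rw [← Multiset.insert_eq_cons, ← Multiset.insert_eq_cons] at key
    rcases pair_eq_pair key with ⟨e₁, e₂⟩ | ⟨e₁, e₂⟩
    · exact ⟨0, by rw [e₁, e₂]; push_cast; linear_combination ha - hconj⟩
    · exact ⟨a, by rw [e₁, e₂]; linear_combination ha + hconj⟩
  -- (7) CC∞: the central character of `σ₀` as a GL(1) datum with parameter `{s₁ + s₂}`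
  obtain ⟨ω, hω, -⟩ := stub_centralCharacterArch 2 K h2 h1 σ₀ _ two_pos hσ₀par'
  have hω' : ω.1.HasArchParameter (fun ι => {s₁ ι + s₂ ι}) := by
    have e : (fun ι => ({(({s₁ ι, s₂ ι} : Multiset ℂ)).sum} : Multiset ℂ)) = fun ι => {s₁ ι + s₂ ι} := by
      funext ι
      simp [Multiset.insert_eq_cons]
    rw [← e]
    exact hω
  -- (8) the CM lever (route item `HalfIntegralTwistCM`, by name)
  obtain ⟨χ, p, hχ, hp⟩ := hTwist K hK h1 s₁ s₂ (fun ι => (hgap ι).imp fun a h => h.2)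
    (fun ι => (hpair ι).1) hiii ⟨ω, hω'⟩
  -- (9) the re-twist, realised and certified regular algebraic
  obtain ⟨σ, hσRA, htw⟩ :=
    stub_twistRealisation K h1 h2 σ₀ χ s₁ s₂ p hσ₀par' hχ hgap (fun ι => (hpair ι).1) hp
  -- (10) assemble: Satake transport of non-dihedrality and of the adjoint relation
  refine ⟨σ, ν, hσRA, hνRA, fun L _ _ _ hL hdi => hnd L hL (selfTwist_transport _ htw hdi), ?_⟩
  exact adRel_transport had htw

end Glue

end Summit.Langlands.Langlands.Cruxes.RegularAdjointLiftCM.PeterssonHermitianParity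

end
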